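import Summits.QuantumFields.YangMills.Theorems.QuantileBitPuritySU2ClassShiftRay
import Summits.QuantumFields.YangMills.Theorems.FemtoTransferGap
import Literature.MathematicalPhysics.QuantumFieldTheory.StrongCouplingActivities
import Mathlib.MeasureTheory.Integral.Marginal
import HarnessLib

/-!
# The own-axis shift of ONE LINK of a lattice configuration: the Jacobian bound lifted to the a-priori measure of the spatial torus

Support module (`--supports` stmt-QuantumFields-23948; memo HOME `bc/g14-dw/PLAN-PERIODIC.md` §B(γ)/§C).  A covariant sheet translate shifts the sheet link
`W = U(e₀)` of a line by the own-axis shift of the LINE HOLONOMY `P = W · R(U)` (`R(U)` = the ordered product of the other links of the line — any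
measurable function of the configuration NOT depending on `U(e₀)`): `W ↦ classShift θ (W·R) · R⁻¹`, so that `P ↦ classShift θ P`.  Fubini over the
other links (Mathlib `lmarginal`), right invariance of the one-link Haar measure (`W ↦ W·R`) and the one-link Jacobian lemma
`ClassShift.lintegral_indicator_classShift_le` (`Theorems/QuantileBitPuritySU2ClassShiftRay.lean`) give:

★ `lintegral_indicator_update_classShift_le`:  `∫ 𝟙_{exp(ι shell)}(U(e₀)·R(U)) · F(update U e₀ (classShift θ (U(e₀)·R(U)) · R(U)⁻¹)) dU ≤ ρ ∫ F dU`
on `configMeasure SU2 L`, for every measurable `F ≥ 0`, with the shell ∕ `θ` ∕ `ρ` hypotheses of the one-link lemma.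

HONEST FRAMING: a change-of-variables inequality on a finite product of compact groups; no estimate of any lattice cost; nothing about infinite volume, the
continuum limit or the Clay gap.  No `sorry`, no new axiom, no new definition.  References: [folklore].
-/

set_option autoImplicit false

noncomputable section

open MeasureTheory Set Metric Function NormedSpace
open scoped ENNReal Real

namespace Summit.QuantumFields.YangMills.Theorems.FemtoTransferGap.ClassShift

open Literature.MathematicalPhysics.QuantumFieldTheory (haarProbability GaugeConfig Edge)
open Literature.MathematicalPhysics.QuantumFieldTheory.Balaban1983to89.T4HaarSU2ExpChart (expPoint)
open Summit.QuantumFields.YangMills.Theorems.FemtoTransferGap (configMeasure SU2)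

variable {L : ℕ} [NeZero L]

/-- ★ **One link of a configuration: the own-axis shift of its line holonomy costs at most the one-link Jacobian.**  Let `R : GaugeConfig → SU(2)` be
measurable and independent of the link `e₀`; on the event that the line holonomy `U(e₀)·R(U)` lies in the chart shell `a ≤ ‖x‖ ≤ b` (`0 < a`, `b < π`),
replace `U(e₀)` by `classShift θ (U(e₀)·R(U)) · R(U)⁻¹` (`0 < a + θ`, `b + θ < π`, `sin² r ≤ ρ sin²(r+θ)` on `[a,b]`).  Then for every measurable `F ≥ 0`:
`∫ 𝟙_{shell}(U(e₀)·R(U)) F(shifted U) dU ≤ ρ ∫ F dU`. [folklore] -/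
theorem lintegral_indicator_update_classShift_le (e₀ : Edge 3 L) {R : GaugeConfig 3 L SU2 → SU2} (hRm : Measurable R)
    (hR : ∀ (U : GaugeConfig 3 L SU2) (W : SU2), R (update U e₀ W) = R U)
    {θ a b ρ : ℝ} (ha : 0 < a) (hbπ : b < π) (haθ : 0 < a + θ) (hbθ : b + θ < π) (hρ : 0 ≤ ρ)
    (hsin : ∀ r : ℝ, a ≤ r → r ≤ b → Real.sin r ^ 2 ≤ ρ * Real.sin (r + θ) ^ 2)
    (F : GaugeConfig 3 L SU2 → ℝ≥0∞) (hF : Measurable F) :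
    ∫⁻ U, (expPoint '' {x : EuclideanSpace ℝ (Fin 3) | a ≤ ‖x‖ ∧ ‖x‖ ≤ b}).indicator (fun _ => (1 : ℝ≥0∞)) (U e₀ * R U) *
        F (update U e₀ (classShift θ (U e₀ * R U) * (R U)⁻¹)) ∂configMeasure SU2 L ≤
      ENNReal.ofReal ρ * ∫⁻ U, F U ∂configMeasure SU2 L := by
  classical
  set S : Set (EuclideanSpace ℝ (Fin 3)) := {x | a ≤ ‖x‖ ∧ ‖x‖ ≤ b} with hSdef
  have hW : MeasurableSet (expPoint '' S) :=
    Literature.MathematicalPhysics.QuantumFieldTheory.Balaban1983to89.T4HaarSU2ExpChart.measurableSet_image_expPoint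
      (measurableSet_shell a b) (shell_subset_ball hbπ)
  -- the two integrands
  set G₁ : GaugeConfig 3 L SU2 → ℝ≥0∞ := fun U =>
    (expPoint '' S).indicator (fun _ => (1 : ℝ≥0∞)) (U e₀ * R U) * F (update U e₀ (classShift θ (U e₀ * R U) * (R U)⁻¹)) with hG₁
  set G₂ : GaugeConfig 3 L SU2 → ℝ≥0∞ := fun U => ENNReal.ofReal ρ * F U with hG₂
  have hP : Measurable fun U : GaugeConfig 3 L SU2 => U e₀ * R U := (measurable_pi_apply e₀).mul hRm
  have hG₁m : Measurable G₁ := by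
    have h1 : Measurable fun U : GaugeConfig 3 L SU2 => (expPoint '' S).indicator (fun _ => (1 : ℝ≥0∞)) (U e₀ * R U) :=
      (measurable_const.indicator hW).comp hP
    have hf : Measurable fun U : GaugeConfig 3 L SU2 => classShift θ (U e₀ * R U) * (R U)⁻¹ := ((measurable_classShift θ).comp hP).mul hRm.inv
    have h2 : Measurable fun U : GaugeConfig 3 L SU2 => update U e₀ (classShift θ (U e₀ * R U) * (R U)⁻¹) :=
      measurable_update'.comp (measurable_id.prodMk hf)
    exact h1.mul (hF.comp h2)
  have hG₂m : Measurable G₂ := hF.const_mul _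
  -- reduce to the `e₀`-marginal
  have hconf : configMeasure SU2 L = Measure.pi fun _ : Edge 3 L => haarProbability SU2 := rfl
  have hRHS : ENNReal.ofReal ρ * ∫⁻ U, F U ∂configMeasure SU2 L = ∫⁻ U, G₂ U ∂configMeasure SU2 L := by
    rw [hG₂, lintegral_const_mul _ hF]
  rw [hRHS]
  show ∫⁻ U, G₁ U ∂configMeasure SU2 L ≤ ∫⁻ U, G₂ U ∂configMeasure SU2 L
  rw [hconf, lintegral_eq_lmarginal_univ (fun _ => (1 : SU2)), lintegral_eq_lmarginal_univ (fun _ => (1 : SU2))]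
  refine lmarginal_le_of_subset (Finset.subset_univ {e₀}) hG₁m hG₂m ?_ _
  rw [lmarginal_singleton, lmarginal_singleton]
  intro x
  -- the one-link inequality at the base point `x`
  set r : SU2 := R x with hr
  have hRx : ∀ W : SU2, R (update x e₀ W) = r := fun W => hR x W
  have h1 : ∀ W : SU2, G₁ (update x e₀ W) =
      (expPoint '' S).indicator (fun _ => (1 : ℝ≥0∞)) (W * r) * F (update x e₀ (classShift θ (W * r) * r⁻¹)) := fun W => by
    simp only [hG₁, update_self, hRx, update_idem]
  have h2 : ∀ W : SU2, G₂ (update x e₀ W) = ENNReal.ofReal ρ * F (update x e₀ W) := fun W => rfl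
  simp only [h1, h2]
  -- right translation `W ↦ W r` on the link, then the one-link Jacobian lemma for `F' V = F(update x e₀ (V r⁻¹))`
  have hupd : Measurable (update x e₀) := measurable_update x
  have hF' : Measurable fun V : SU2 => F (update x e₀ (V * r⁻¹)) := hF.comp (hupd.comp (measurable_id.mul_const _))
  have hFW : Measurable fun W : SU2 => F (update x e₀ W) := hF.comp hupd
  have hkey := lintegral_indicator_classShift_le ha hbπ haθ hbθ hρ hsin (fun V : SU2 => F (update x e₀ (V * r⁻¹))) hF'
  have hind : ∀ V : SU2, (expPoint '' S).indicator (fun _ => (1 : ℝ≥0∞)) V * F (update x e₀ (classShift θ V * r⁻¹)) =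
      (expPoint '' S).indicator (fun V => F (update x e₀ (classShift θ V * r⁻¹))) V := fun V => by
    by_cases hV : V ∈ expPoint '' S
    · rw [indicator_of_mem hV, indicator_of_mem hV, one_mul]
    · rw [indicator_of_notMem hV, indicator_of_notMem hV, zero_mul]
  calc ∫⁻ W, (expPoint '' S).indicator (fun _ => (1 : ℝ≥0∞)) (W * r) * F (update x e₀ (classShift θ (W * r) * r⁻¹)) ∂haarProbability SU2
      = ∫⁻ V, (expPoint '' S).indicator (fun _ => (1 : ℝ≥0∞)) V * F (update x e₀ (classShift θ V * r⁻¹)) ∂haarProbability SU2 :=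
        lintegral_mul_right_eq_self (fun V : SU2 => (expPoint '' S).indicator (fun _ => (1 : ℝ≥0∞)) V * F (update x e₀ (classShift θ V * r⁻¹))) r
    _ = ∫⁻ V, (expPoint '' S).indicator (fun V => F (update x e₀ (classShift θ V * r⁻¹))) V ∂haarProbability SU2 := lintegral_congr hind
    _ ≤ ENNReal.ofReal ρ * ∫⁻ V, F (update x e₀ (V * r⁻¹)) ∂haarProbability SU2 := hkey
    _ = ENNReal.ofReal ρ * ∫⁻ W, F (update x e₀ W) ∂haarProbability SU2 := by
        rw [lintegral_mul_right_eq_self (fun W : SU2 => F (update x e₀ W)) r⁻¹]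
    _ = ∫⁻ W, ENNReal.ofReal ρ * F (update x e₀ W) ∂haarProbability SU2 := (lintegral_const_mul (ENNReal.ofReal ρ) hFW).symm

end Summit.QuantumFields.YangMills.Theorems.FemtoTransferGap.ClassShift

end
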